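import Summits.Ventures.Crystal3D.Theorems.StickyWulffConstantGenericWallFloorSlotTriples
import Summits.Ventures.Crystal3D.Theorems.StickyWulffConstantGenericWallFloorTwinFrame
import HarnessLib

/-!
# Chamber facts for the chain ledger (cf-p1 ROUTE §81(3) TC-2): the steepest slot, its four
# up-neighbours, and the closed vertex star `P₅` owned by a top above a covered ball
# (crux `GenericWallFloor`, line `WallLedgerG`; planner's ask §81(8) to wulff-p2)

HONEST FRAMING. Part of the venture `Summits/Ventures/Crystal3D` (cell `crystal3d-full`), helper
`--supports` the crux `GenericWallFloor` (stmt-Ventures-19480), registered line `WallLedgerG`, open stub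
`stub_twoSlabAdhesion`.  The planner's CHAIN LEDGER (§81(3), typed target N-TC `twoSlabAdhesion_chainLedger`)
follows, for a generic direction `n` (no two slots at the same height, none at height `0`), the steepest
slot `δ₀` of each grain line from the plate to its first TOP; TC-2 says the top owns the CLOSED VERTEX STAR
of `−δ₀` (the pattern `P₅ = C12-55`, the one E1 row everything generic reduces to).  This file proves the
frame-free slot facts behind TC-2, WITHOUT `decide`:

* `argmax_pos`, **`pos_of_adj_argmax`** — the strict maximiser `δ₀` of `w ↦ ⟪A w, n⟫` is positive and its
  four cuboctahedral neighbours are UP-slots (because `δ₀ − w` is again a slot: `sub_adj_mem_fccSlots`);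
  `inner_eq_zero_of_up_not_adj` — any other up-slot is square-opposite to `δ₀`;
* `mem_closedStar_iff` — the closed star `{−δ₀} ∪ N(−δ₀)` is the open hemisphere `{w : ⟪A w, A δ₀⟫ < 0}`;
* **`top_owns_closedStar`** (TC-2) — if `b ∈ X` is COVERED (`b + A w ∈ X` for every up-slot) then
  `t = b + A δ₀` has `t + A w ∈ X` for every `w` in the closed star of `−δ₀`;
  **`top_three_independent`** — hence three linearly independent occupied slots at `t`
  (`exists_independent_slots_of_hemisphere`), i.e. the hypothesis of `trichotomy_of_exactOnly` /
  `slots_full_or_twinCap_of_allButOne` (…Trichotomy);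
* `chain_owns_lower` — a chain ball `b′ + A δ₀` over a covered `b′` owns every down-slot not orthogonal to
  `δ₀` (the planner's `own(b) ⊇ L6 ∖ {−δ₅}`).

CAVEAT recorded for N-TC (checked by hand in the chamber `a > b > c > 0`, `δ₀ = (1,1,0)`, `δ₅ = (1,−1,0)`):
of the five coverers `b + δᵢ` of a covered chain ball, the three along `(1,0,±1)` and `δ₅` own the full
closed star of `−δᵢ`, but the two along `(0,1,±1)` (the neighbours of `δ₀` adjacent to `−δ₅`) miss the
star site `b − δ₅`, which nothing forces to be occupied — so «every coverer owns a vertex star» needs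
`b − δ₅ ∈ X` for those two (INBOX to cf-p1 g23).

WHAT THIS IS NOT: not the chain ledger itself (injectivity / counting / rim), not the stub; F-C1 not moved.
-/

noncomputable section

namespace Summit.Ventures.Crystal3D.Theorems

open Finset
open Literature.MathematicalPhysics.StatisticalMechanics (fccStacking constHagg)
open Literature.Barriers.AtomisticToContinuum (barlowAddSubgroupOfConst)
open scoped InnerProductSpace

variable {X : Finset (EuclideanSpace ℝ (Fin 3))}

/-! ### Slot pairs -/

/-- A slot at inner product `1` is the same slot; at `−1` the antipode. -/
theorem eq_of_inner_eq_one {w₀ w₁ : EuclideanSpace ℝ (Fin 3)} (hw₀ : w₀ ∈ fccSlots) (hw₁ : w₁ ∈ fccSlots)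
    (h : ⟪w₀, w₁⟫_ℝ = 1) : w₁ = w₀ := by
  have : ‖w₁ - w₀‖ ^ 2 = 0 := by
    rw [norm_sub_sq_real, norm_eq_one_of_mem_fccSlots hw₀, norm_eq_one_of_mem_fccSlots hw₁, real_inner_comm, h]
    norm_num
  exact sub_eq_zero.1 (norm_eq_zero.1 (pow_eq_zero_iff two_ne_zero |>.1 this))

/-- A slot at inner product `−1` is the antipode. -/
theorem eq_neg_of_inner_eq_neg_one {w₀ w₁ : EuclideanSpace ℝ (Fin 3)} (hw₀ : w₀ ∈ fccSlots)
    (hw₁ : w₁ ∈ fccSlots) (h : ⟪w₀, w₁⟫_ℝ = -1) : w₁ = -w₀ := by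
  have : ‖w₁ + w₀‖ ^ 2 = 0 := by
    rw [norm_add_sq_real, norm_eq_one_of_mem_fccSlots hw₀, norm_eq_one_of_mem_fccSlots hw₁, real_inner_comm, h]
    norm_num
  exact eq_neg_of_add_eq_zero_left (norm_eq_zero.1 (pow_eq_zero_iff two_ne_zero |>.1 this))

/-- The sum of two slots at `120°` and the difference of two slots at `60°` are slots. -/
theorem add_mem_fccSlots_of_inner_eq_neg_half {w₀ w₁ : EuclideanSpace ℝ (Fin 3)} (hw₀ : w₀ ∈ fccSlots)
    (hw₁ : w₁ ∈ fccSlots) (h : ⟪w₀, w₁⟫_ℝ = -(1 / 2)) : w₀ + w₁ ∈ fccSlots := by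
  set G₁ : AddSubgroup (EuclideanSpace ℝ (Fin 3)) :=
    barlowAddSubgroupOfConst 1 (Real.sqrt (2 / 3)) constHagg (fun _ => rfl) with hG₁
  have hG₁mem : ∀ w, w ∈ G₁ ↔ w ∈ fccStacking 1 (Real.sqrt (2 / 3)) := fun w => Iff.rfl
  have hmem : w₀ + w₁ ∈ fccStacking 1 (Real.sqrt (2 / 3)) :=
    (hG₁mem _).1 (G₁.add_mem ((hG₁mem _).2 (mem_fcc_of_mem_fccSlots hw₀))
      ((hG₁mem _).2 (mem_fcc_of_mem_fccSlots hw₁)))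
  have h1 : ‖w₀ + w₁‖ ^ 2 = 1 ^ 2 := by
    rw [norm_add_sq_real, norm_eq_one_of_mem_fccSlots hw₀, norm_eq_one_of_mem_fccSlots hw₁, h]; norm_num
  exact mem_fccSlots_of_unit hmem ((sq_eq_sq₀ (norm_nonneg _) zero_le_one).1 h1)

/-- The difference of two ADJACENT slots is a slot, adjacent to the first:
`⟪w, δ⟫ = ½ ⇒ δ − w ∈ fccSlots ∧ ⟪δ − w, δ⟫ = ½` (the neighbours of `δ` pair off as `w ↔ δ − w`). -/
theorem sub_adj_mem_fccSlots {δ w : EuclideanSpace ℝ (Fin 3)} (hδ : δ ∈ fccSlots) (hw : w ∈ fccSlots)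
    (h : ⟪w, δ⟫_ℝ = 1 / 2) : δ - w ∈ fccSlots ∧ ⟪δ - w, δ⟫_ℝ = 1 / 2 := by
  have hδδ : ⟪δ, δ⟫_ℝ = 1 := by rw [real_inner_self_eq_norm_sq, norm_eq_one_of_mem_fccSlots hδ, one_pow]
  refine ⟨?_, by rw [inner_sub_left, hδδ, h]; norm_num⟩
  have : δ + -w ∈ fccSlots := add_mem_fccSlots_of_inner_eq_neg_half hδ (neg_mem_fccSlots hw)
    (by rw [inner_neg_right, real_inner_comm, h])
  simpa [sub_eq_add_neg] using this

/-! ### The steepest slot of a generic direction -/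

/-- **The steepest slot is positive.**  If `δ₀` is the STRICT maximiser of `w ↦ ⟪A w, n⟫` over the
twelve slots, then `⟪A δ₀, n⟫ > 0`. -/
theorem argmax_pos (A : EuclideanSpace ℝ (Fin 3) ≃ₗᵢ[ℝ] EuclideanSpace ℝ (Fin 3)) (n : EuclideanSpace ℝ (Fin 3))
    {δ₀ : EuclideanSpace ℝ (Fin 3)} (hδ₀ : δ₀ ∈ fccSlots)
    (hmax : ∀ w ∈ fccSlots, w ≠ δ₀ → ⟪A w, n⟫_ℝ < ⟪A δ₀, n⟫_ℝ) : 0 < ⟪A δ₀, n⟫_ℝ := by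
  have hne : -δ₀ ≠ δ₀ := by
    intro h
    have h0 : δ₀ = 0 := by
      have : (2 : ℝ) • δ₀ = 0 := by rw [two_smul]; nth_rewrite 1 [← h]; simp
      exact (smul_eq_zero.1 this).resolve_left two_ne_zero
    have := norm_eq_one_of_mem_fccSlots hδ₀
    rw [h0, norm_zero] at this; exact one_ne_zero this.symm
  have h := hmax (-δ₀) (neg_mem_fccSlots hδ₀) hne
  rw [map_neg, inner_neg_left] at h
  linarith

/-- **The four neighbours of the steepest slot are up-slots** (chamber fact 1 of TC-2): if `δ₀` is the
strict maximiser of `w ↦ ⟪A w, n⟫`, every slot `w` adjacent to `δ₀` (`⟪w, δ₀⟫ = ½`) has `⟪A w, n⟫ > 0` —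
because `δ₀ − w` is another slot, so `⟪A(δ₀ − w), n⟫ < ⟪A δ₀, n⟫`. -/
theorem pos_of_adj_argmax (A : EuclideanSpace ℝ (Fin 3) ≃ₗᵢ[ℝ] EuclideanSpace ℝ (Fin 3))
    (n : EuclideanSpace ℝ (Fin 3)) {δ₀ : EuclideanSpace ℝ (Fin 3)} (hδ₀ : δ₀ ∈ fccSlots)
    (hmax : ∀ w ∈ fccSlots, w ≠ δ₀ → ⟪A w, n⟫_ℝ < ⟪A δ₀, n⟫_ℝ)
    {w : EuclideanSpace ℝ (Fin 3)} (hw : w ∈ fccSlots) (hadj : ⟪w, δ₀⟫_ℝ = 1 / 2) : 0 < ⟪A w, n⟫_ℝ := by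
  obtain ⟨hs, hsadj⟩ := sub_adj_mem_fccSlots hδ₀ hw hadj
  have hne : δ₀ - w ≠ δ₀ := by
    intro h
    have hw0 : w = 0 := by simpa using h
    have := norm_eq_one_of_mem_fccSlots hw
    rw [hw0, norm_zero] at this; exact one_ne_zero this.symm
  have h := hmax _ hs hne
  rw [map_sub, inner_sub_left] at h
  linarith

/-- **The sixth up-slot is square-opposite to the steepest** (chamber fact 2): an up-slot `w ≠ δ₀` that is
not adjacent to `δ₀` is orthogonal to it. -/
theorem inner_eq_zero_of_up_not_adj (A : EuclideanSpace ℝ (Fin 3) ≃ₗᵢ[ℝ] EuclideanSpace ℝ (Fin 3))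
    (n : EuclideanSpace ℝ (Fin 3)) {δ₀ : EuclideanSpace ℝ (Fin 3)} (hδ₀ : δ₀ ∈ fccSlots)
    (hmax : ∀ w ∈ fccSlots, w ≠ δ₀ → ⟪A w, n⟫_ℝ < ⟪A δ₀, n⟫_ℝ)
    {w : EuclideanSpace ℝ (Fin 3)} (hw : w ∈ fccSlots) (hne : w ≠ δ₀) (hup : 0 < ⟪A w, n⟫_ℝ)
    (hnadj : ⟪w, δ₀⟫_ℝ ≠ 1 / 2) : ⟪w, δ₀⟫_ℝ = 0 := by
  have h0 := argmax_pos A n hδ₀ hmax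
  rcases inner_slots_mem hw hδ₀ with h | h | h | h | h
  · exact absurd (eq_of_inner_eq_one hw hδ₀ h).symm hne
  · exact absurd h hnadj
  · exact h
  · -- `δ₀ + w` would be a steeper slot
    exfalso
    have hs : δ₀ + w ∈ fccSlots := add_mem_fccSlots_of_inner_eq_neg_half hδ₀ hw (by rw [real_inner_comm, h])
    have hne' : δ₀ + w ≠ δ₀ := by
      intro e
      have hw0 : w = 0 := by simpa using e
      have := norm_eq_one_of_mem_fccSlots hw
      rw [hw0, norm_zero] at this; exact one_ne_zero this.symm
    have := hmax _ hs hne'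
    rw [map_add, inner_add_left] at this
    linarith
  · -- `w = −δ₀` is a down-slot
    exfalso
    have := eq_neg_of_inner_eq_neg_one hw hδ₀ h
    have hw' : w = -δ₀ := by rw [this, neg_neg]
    rw [hw', map_neg, inner_neg_left] at hup
    linarith

/-! ### The closed vertex star owned by a top -/

/-- **The closed vertex star of `−δ₀` is the open hemisphere of `−δ₀`**: for slots,
`w = −δ₀ ∨ ⟪w, −δ₀⟫ = ½  ↔  ⟪A w, A δ₀⟫ < 0`. -/
theorem mem_closedStar_iff (A : EuclideanSpace ℝ (Fin 3) ≃ₗᵢ[ℝ] EuclideanSpace ℝ (Fin 3))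
    {δ₀ w : EuclideanSpace ℝ (Fin 3)} (hδ₀ : δ₀ ∈ fccSlots) (hw : w ∈ fccSlots) :
    (w = -δ₀ ∨ ⟪w, -δ₀⟫_ℝ = 1 / 2) ↔ ⟪A w, A δ₀⟫_ℝ < 0 := by
  rw [LinearIsometryEquiv.inner_map_map, inner_neg_right]
  have hδδ : ⟪δ₀, δ₀⟫_ℝ = 1 := by rw [real_inner_self_eq_norm_sq, norm_eq_one_of_mem_fccSlots hδ₀, one_pow]
  constructor
  · rintro (rfl | h)
    · rw [inner_neg_left, hδδ]; norm_num
    · linarith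
  · intro hlt
    rcases inner_slots_mem hw hδ₀ with h | h | h | h | h
    · linarith
    · linarith
    · linarith
    · right; rw [h]; norm_num
    · left; exact eq_neg_of_inner_eq_neg_one hδ₀ hw (by rw [real_inner_comm]; exact h)

/-- **TC-2 (forced own pattern of a top above a covered ball).**  Let `δ₀` be the steepest slot of the
generic direction `n` for the grain `A`, and let `b ∈ X` be COVERED: `b + A w ∈ X` for every up-slot
(`⟪A w, n⟫ > 0`).  Then the next ball `t = b + A δ₀` on the `δ₀`-line owns the whole CLOSED VERTEX STAR of
`−δ₀`: `t + A w ∈ X` for every slot `w` with `⟪A w, A δ₀⟫ < 0` (i.e. `w = −δ₀`, giving `b`, or `w` one of the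
four neighbours of `−δ₀`, giving the coverers `b + A(δ₀ + w)`) — the pattern `P₅ = C12-55`. -/
theorem top_owns_closedStar (A : EuclideanSpace ℝ (Fin 3) ≃ₗᵢ[ℝ] EuclideanSpace ℝ (Fin 3))
    (n : EuclideanSpace ℝ (Fin 3)) {δ₀ : EuclideanSpace ℝ (Fin 3)} (hδ₀ : δ₀ ∈ fccSlots)
    (hmax : ∀ w ∈ fccSlots, w ≠ δ₀ → ⟪A w, n⟫_ℝ < ⟪A δ₀, n⟫_ℝ)
    {b : EuclideanSpace ℝ (Fin 3)} (hb : b ∈ X) (hcov : ∀ w ∈ fccSlots, 0 < ⟪A w, n⟫_ℝ → b + A w ∈ X)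
    {w : EuclideanSpace ℝ (Fin 3)} (hw : w ∈ fccSlots) (hstar : ⟪A w, A δ₀⟫_ℝ < 0) :
    b + A δ₀ + A w ∈ X := by
  rcases (mem_closedStar_iff A hδ₀ hw).2 hstar with rfl | h
  · rw [map_neg, add_neg_cancel_right]; exact hb
  · -- `δ₀ + w` is a neighbour of `δ₀`, hence an up-slot, hence `b + A(δ₀ + w) ∈ X`
    have h' : ⟪δ₀, w⟫_ℝ = -(1 / 2) := by
      rw [inner_neg_right] at h; rw [real_inner_comm]; linarith
    have hs : δ₀ + w ∈ fccSlots := add_mem_fccSlots_of_inner_eq_neg_half hδ₀ hw h'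
    have hδδ : ⟪δ₀, δ₀⟫_ℝ = 1 := by rw [real_inner_self_eq_norm_sq, norm_eq_one_of_mem_fccSlots hδ₀, one_pow]
    have hadj : ⟪δ₀ + w, δ₀⟫_ℝ = 1 / 2 := by rw [inner_add_left, hδδ, real_inner_comm, h']; norm_num
    have hup := pos_of_adj_argmax A n hδ₀ hmax hs hadj
    have := hcov _ hs hup
    rw [map_add, ← add_assoc] at this
    exact this

/-- **The top has three linearly independent occupied slots** (so `trichotomy_of_exactOnly` /
`slots_full_or_twinCap_of_allButOne` apply to it): the closed vertex star of `−δ₀` is a hemisphere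
pattern. -/
theorem top_three_independent (A : EuclideanSpace ℝ (Fin 3) ≃ₗᵢ[ℝ] EuclideanSpace ℝ (Fin 3))
    (n : EuclideanSpace ℝ (Fin 3)) {δ₀ : EuclideanSpace ℝ (Fin 3)} (hδ₀ : δ₀ ∈ fccSlots)
    (hmax : ∀ w ∈ fccSlots, w ≠ δ₀ → ⟪A w, n⟫_ℝ < ⟪A δ₀, n⟫_ℝ)
    {b : EuclideanSpace ℝ (Fin 3)} (hb : b ∈ X) (hcov : ∀ w ∈ fccSlots, 0 < ⟪A w, n⟫_ℝ → b + A w ∈ X) :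
    ∃ w₁ ∈ fccSlots, ∃ w₂ ∈ fccSlots, ∃ w₃ ∈ fccSlots,
      b + A δ₀ + A w₁ ∈ X ∧ b + A δ₀ + A w₂ ∈ X ∧ b + A δ₀ + A w₃ ∈ X ∧ LinearIndependent ℝ ![w₁, w₂, w₃] := by
  have hν : A δ₀ ≠ 0 := by
    intro h
    have := norm_eq_one_of_mem_fccSlots hδ₀
    rw [← A.norm_map, h, norm_zero] at this; exact one_ne_zero this.symm
  obtain ⟨w₁, hw₁, w₂, hw₂, w₃, hw₃, h₁, h₂, h₃, hind⟩ := exists_independent_slots_of_hemisphere A hν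
  exact ⟨w₁, hw₁, w₂, hw₂, w₃, hw₃, top_owns_closedStar A n hδ₀ hmax hb hcov hw₁ h₁,
    top_owns_closedStar A n hδ₀ hmax hb hcov hw₂ h₂, top_owns_closedStar A n hδ₀ hmax hb hcov hw₃ h₃, hind⟩

/-- **Lower own slots of a chain ball.**  If `b′` is covered and `b = b′ + A δ₀`, then every DOWN-slot `s`
of `b` (`⟪A s, n⟫ < 0`) that is not orthogonal to `δ₀` is occupied: `b + A s ∈ X` — all of the lower
hemisphere of `b` except the slot square-opposite to `−δ₀` (the planner's `own₁(b) ⊇ L6 ∖ {−δ₅}`). -/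
theorem chain_owns_lower (A : EuclideanSpace ℝ (Fin 3) ≃ₗᵢ[ℝ] EuclideanSpace ℝ (Fin 3))
    (n : EuclideanSpace ℝ (Fin 3)) {δ₀ : EuclideanSpace ℝ (Fin 3)} (hδ₀ : δ₀ ∈ fccSlots)
    (hmax : ∀ w ∈ fccSlots, w ≠ δ₀ → ⟪A w, n⟫_ℝ < ⟪A δ₀, n⟫_ℝ)
    {b' : EuclideanSpace ℝ (Fin 3)} (hb' : b' ∈ X) (hcov : ∀ w ∈ fccSlots, 0 < ⟪A w, n⟫_ℝ → b' + A w ∈ X)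
    {s : EuclideanSpace ℝ (Fin 3)} (hs : s ∈ fccSlots) (hdown : ⟪A s, n⟫_ℝ < 0) (hno : ⟪s, δ₀⟫_ℝ ≠ 0) :
    b' + A δ₀ + A s ∈ X := by
  have hlt : ⟪A s, A δ₀⟫_ℝ < 0 := by
    rw [LinearIsometryEquiv.inner_map_map]
    rcases inner_slots_mem hs hδ₀ with h | h | h | h | h
    · exfalso
      have := eq_of_inner_eq_one hs hδ₀ h
      rw [← this] at hdown; linarith [argmax_pos A n hδ₀ hmax]
    · exfalso
      have := pos_of_adj_argmax A n hδ₀ hmax hs h; linarith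
    · exact absurd h hno
    · rw [h]; norm_num
    · rw [h]; norm_num
  exact top_owns_closedStar A n hδ₀ hmax hb' hcov hs hlt

end Summit.Ventures.Crystal3D.Theorems

end
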